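import Summits.HubbardSuperconductivity.HubbardLadder.PairSourceEnergyCeilingAlong
import Literature.MathematicalPhysics.QuantumLattice.PairFieldCommutatorLocalityTT
import Literature.MathematicalPhysics.QuantumLattice.DWaveSourceNNNHoppingOrderParameter
import HarnessLib

/-!
# Route #2 (sourced energy response ⇒ pair-LRO CEILING) at diagonal hopping `t'`:
# the Koma–Tasaki Thm 2.2 eigenvector inequality for the `t–t'` Hubbard torus

HONEST FRAMING: this file certifies NO number and makes no claim on `H`/`H₀` or on the CUPRATE QUESTION;
every statement is a PROVED implication whose numerical inputs (a canonical UPPER row on the `t–t'` sector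
energy, a SOURCED LOWER row on the pair-sourced grand-canonical energy) are hypotheses of the stated shape —
no instance is constructed or claimed. Cell hubbard-cq (D-0082 (c) / D-0085; LADDER rung CQ at
`(U, δ, t') = (8, 1/8, −1/4)`, ABSENT/BOUNDED branch), seat hubbard-cq-obsth-3 (`prover-hubbard-cq-obsth-3-g0-0`),
START-HERE §4 obsth item (3)-class «sourced rows ⇒ pair-LRO ceiling». It is the `t'`-TWIN of the pub-hubbard
route-#2 files `PairSourceEnergySlack.lean` §2 / `PairSourceEnergyCeilingAlong.lean` §1–§2 (`t' = 0`), whose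
abstract §1 (`groundEnergy_source_mul_le_of_eigen`, `normSq_le_of_slack`) is reused verbatim.

Objects (tree): `K_L = hubbardTorusTT' L 1 t' U − μN` (Xu et al. 2024 eq. (1), grand canonical),
`O = Δ_d + Δ_d†`, `Δ_d = pairField dWaveFormFactor L`, the pair-sourced torus
`A_L(h) = K_L − hO = dWaveSourceTorusTT' L t' U μ h` (`DWaveSourceNNNHopping.lean`), sector ground states
`IsGroundStateInSector (hubbardTorusTT' L 1 t' U) N 0 ψ`, the pair-field density `pairFieldDensity L ψ =
L⁻⁴ Re⟨ψ, Δ_d†Δ_d ψ⟩` and the order-parameter sequence `dWaveOrderParamSq ψ k = p_d(2k; ψ_{2k})`.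

* §1 `exists_doubleCommutator_budget_TT'` — `−Re⟨ψ, [O,[O,K_L]] ψ⟩ ≤ D·L²` for all unit `ψ` and `L ≥ L₀`
  (`D = D(t',U,μ) ≥ 0`): `K_L = (H_L(1,U) − μN) + H_L(0,t',0)` (nearest-neighbour grand-canonical part, budget
  `kt_norm_doubleCommutator_le` with `B₂(1+|U|+|μ|)`; diagonal-hopping part, budget
  `exists_norm_expect_doubleCommutator_pairField_le_TT'` at `(t,t',U) = (0,t',0)`), and the double commutator is
  additive in `K`.
* §2 `two_mul_re_pair_le_of_sourcedSlack_TT'` — for every unit `(N, S^z = 0)`-sector ground state `ψ` of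
  `hubbardTorusTT' L 1 t' U`, `L ≥ L₀`, every `h > 0`, `S > 0` with the SOURCED SLACK
  `E_N^{t'}(L) − μN − E₀(A_L(h)) ≤ S`: `2Re⟨ψ, Δ_d†Δ_d ψ⟩ ≤ S²/h² + D L²/(2S) + B_p L²` (Koma–Tasaki Thm 2.2 /
  Kaplan–Horsch–von der Linden, eigenvector form; selection rules from particle-number conservation).
* §3 `pairFieldDensity_le_of_sourcedSlack_TT'` (`S = sL²` ⇒ `p_d(L;ψ) ≤ s²/(2h²) + C/L²`) and the ROWS form
  `liminf_dWaveOrderParamSq_le_of_sourcedRows_TT'`: an UPPER row `E_{N_L}^{t'}(L) ≤ e⁺L²` and a SOURCED LOWER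
  row `e⁻L² ≤ E₀(dWaveSourceTorusTT' L t' U μ h)` on the sides `L ≥ L₁` with `d ∣ L` (`d > 0` even), exact
  density `N_L = ρL²` there, and `s := e⁺ − μρ − e⁻ > 0` give, along EVERY admissible sequence of unit
  `(N_L, S^z = 0)`-sector ground states of the `t–t'` tori, `liminf_k σ_d²(2k) ≤ s²/(2h²)`.

Informativeness (labels, not claims): new only when `s²/(2h²)` beats the kinematic ceiling `128/π⁴`
(`limsup_dWaveOrderParamSq_le_kinematic`, `t' = 0` file; the kinematic bound is `t'`-independent); the
upper row at `(8, 7/8, −1/4)` is of record (mbsolver CERTIFIED rows), the sourced lower row is the product of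
the pinning-field menus (`hubbard-cq-pilot-2`) — nothing instantiated here.

References: T. Koma, H. Tasaki, J. Stat. Phys. 76 (1994) 745, Theorem 2.2 and §1; T. A. Kaplan, P. Horsch,
W. von der Linden, J. Phys. Soc. Jpn. 58 (1989) 3894; H. Tasaki, H. Watanabe (2021), discussion after eq. (11)
(`liminf` readings); H. Xu et al., Science 384 (2024) eadh7691, eq. (1).
-/

noncomputable section

namespace Summit.HubbardSuperconductivity.HubbardLadder

open Matrix Filter Literature.Probability.LatticeModels
open Literature.MathematicalPhysics.QuantumLattice
open Summit.HubbardSuperconductivity.HubbardSuperconductivity.Theorems.WcbcsTrialState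
open Summit.HubbardSuperconductivity.HubbardSuperconductivity.Theorems.AbsenceCertificate
  (kt_norm_doubleCommutator_le kt_two_mul_re_pair_le_re_order_sq)
open scoped Matrix.Norms.L2Operator ComplexOrder Topology

/-! ## §1 The double-commutator budget for `K_L = H_L(1,t',U) − μN` -/

section Budget

variable {m : Type*} [Fintype m]

/-- The double commutator `O(OK − KO) − (OK − KO)O` is additive in `K`. -/
private theorem doubleComm_add (O K₁ K₂ : Matrix m m ℂ) :
    O * (O * (K₁ + K₂) - (K₁ + K₂) * O) - (O * (K₁ + K₂) - (K₁ + K₂) * O) * O =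
      (O * (O * K₁ - K₁ * O) - (O * K₁ - K₁ * O) * O) + (O * (O * K₂ - K₂ * O) - (O * K₂ - K₂ * O) * O) := by
  simp only [Matrix.mul_add, Matrix.add_mul, Matrix.mul_sub, Matrix.sub_mul]
  abel

/-- Reversing the inner commutator flips the sign. -/
private theorem doubleComm_swap (O K : Matrix m m ℂ) :
    O * (K * O - O * K) - (K * O - O * K) * O = -(O * (O * K - K * O) - (O * K - K * O) * O) := by
  simp only [Matrix.mul_sub, Matrix.sub_mul]
  abel

variable (L : ℕ) [NeZero L]

omit [NeZero L] in
/-- `hamiltonian G 0 0 = 0`. -/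
private theorem hamiltonian_zero_zero' {Λ : Type*} [LinearOrder Λ] [Fintype Λ] (G : SimpleGraph Λ)
    [DecidableRel G.Adj] : hamiltonian G 0 0 = 0 := by
  simp [hamiltonian]

omit [NeZero L] in
/-- `K_L = (H_L(1,U) − μN) + H_L(0,t',0)`: the grand-canonical `t–t'` Hamiltonian is the nearest-neighbour
grand-canonical Hamiltonian plus the pure diagonal-hopping Hamiltonian. [cite: XuEtAl2024, eq. (1)] -/
theorem hubbardTorusTT'_sub_mu_eq_hubbardTorusWith_add (t' U μ : ℝ) :
    hubbardTorusTT' L 1 t' U - (μ : ℂ) • totalNumber = hubbardTorusWith 2 L 1 U μ + hubbardTorusTT' L 0 t' 0 := by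
  rw [hubbardTorusTT', hubbardTorusTT', hubbardTorusWith_eq, hubbardTorus, hamiltonian_zero_zero', zero_add]
  abel

/-- **Double-commutator budget at `t'`.** For every `t', U, μ` there are `D ≥ 0` and `L₀` with
`−Re⟨ψ, [O,[O,K_L]] ψ⟩ ≤ D·L²` for every unit vector `ψ` on every torus of side `L ≥ L₀`, where
`K_L = hubbardTorusTT' L 1 t' U − μN`, `O = Δ_d + Δ_d†` and `[O,[O,K]] := O(OK − KO) − (OK − KO)O`.
[cite: KomaTasaki1994, Theorem 2.2] -/
theorem exists_doubleCommutator_budget_TT' (t' U μ : ℝ) :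
    ∃ D : ℝ, ∃ L₀ : ℕ, 0 ≤ D ∧ ∀ (L : ℕ) [NeZero L], L₀ ≤ L →
      ∀ ψ : Fock (Orb (FermionTorus 2 L)), star ψ ⬝ᵥ ψ = 1 →
        -(star ψ ⬝ᵥ
            (((pairField dWaveFormFactor L + (pairField dWaveFormFactor L)ᴴ) *
                  ((pairField dWaveFormFactor L + (pairField dWaveFormFactor L)ᴴ) *
                      (hubbardTorusTT' L 1 t' U - (μ : ℂ) • totalNumber) -
                    (hubbardTorusTT' L 1 t' U - (μ : ℂ) • totalNumber) *
                      (pairField dWaveFormFactor L + (pairField dWaveFormFactor L)ᴴ)) -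
                ((pairField dWaveFormFactor L + (pairField dWaveFormFactor L)ᴴ) *
                      (hubbardTorusTT' L 1 t' U - (μ : ℂ) • totalNumber) -
                    (hubbardTorusTT' L 1 t' U - (μ : ℂ) • totalNumber) *
                      (pairField dWaveFormFactor L + (pairField dWaveFormFactor L)ᴴ)) *
                  (pairField dWaveFormFactor L + (pairField dWaveFormFactor L)ᴴ)) *ᵥ ψ)).re ≤
          D * (L : ℝ) ^ 2 := by
  obtain ⟨B₂, hB₂, hDn⟩ := kt_norm_doubleCommutator_le
  obtain ⟨C, L₀, hC, hTT⟩ := exists_norm_expect_doubleCommutator_pairField_le_TT' dWaveFormFactor 0 t' 0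
  refine ⟨B₂ * (1 + |U| + |μ|) + C, L₀, by positivity, fun L _ hL ψ hψ1 => ?_⟩
  set O := pairField dWaveFormFactor L + (pairField dWaveFormFactor L)ᴴ with hO_def
  set K₁ := hubbardTorusWith 2 L 1 U μ with hK₁
  set K₂ := hubbardTorusTT' L 0 t' 0 with hK₂
  rw [hubbardTorusTT'_sub_mu_eq_hubbardTorusWith_add, doubleComm_add, add_mulVec, dotProduct_add,
    Complex.add_re, neg_add]
  have hψn : eucNorm ψ = 1 := eucNorm_eq_one hψ1
  -- nearest-neighbour part: operator-norm budget
  have h1 : -(star ψ ⬝ᵥ ((O * (O * K₁ - K₁ * O) - (O * K₁ - K₁ * O) * O) *ᵥ ψ)).re ≤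
      B₂ * (1 + |U| + |μ|) * (L : ℝ) ^ 2 := by
    have := re_star_dotProduct_mulVec_le (-(O * (O * K₁ - K₁ * O) - (O * K₁ - K₁ * O) * O)) ψ
    rw [neg_mulVec, dotProduct_neg, Complex.neg_re, norm_neg, hψn, one_pow, mul_one] at this
    exact this.trans (hDn L U μ)
  -- diagonal-hopping part: expectation budget (sign reversed inside the tree lemma)
  have h2 : -(star ψ ⬝ᵥ ((O * (O * K₂ - K₂ * O) - (O * K₂ - K₂ * O) * O) *ᵥ ψ)).re ≤ C * (L : ℝ) ^ 2 := by
    have key := hTT L hL ψ hψ1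
    rw [expect, ← hK₂, ← hO_def, doubleComm_swap, neg_mulVec, dotProduct_neg, norm_neg] at key
    exact (neg_le_abs _).trans ((Complex.abs_re_le_norm _).trans key)
  linarith

end Budget

/-! ## §2 The sourced-slack inequality for `t–t'` sector ground states -/

/-- **Route #2 on the `t–t'` Hubbard torus, pointwise.** For every `t', U, μ` there are constants
`D ≥ 0`, `B_p ≥ 0` and a side `L₀` such that on every torus `(ℤ/Lℤ)²`, `L ≥ L₀`, for every `h > 0`, `S > 0`,
every `N` and every normalised ground state `ψ` of `hubbardTorusTT' L 1 t' U` in the sector `(N, S^z = 0)`: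
if `E_N^{t'}(L) − μN − E₀(dWaveSourceTorusTT' L t' U μ h) ≤ S` then
`2 Re⟨ψ, Δ_d†Δ_d ψ⟩ ≤ S²/h² + D L²/(2S) + B_p L²`. [cite: KomaTasaki1994, Theorem 2.2]
[cite: KaplanHorschVonDerLinden1989] -/
theorem two_mul_re_pair_le_of_sourcedSlack_TT' (t' U μ : ℝ) :
    ∃ D Bp : ℝ, ∃ L₀ : ℕ, 0 ≤ D ∧ 0 ≤ Bp ∧ ∀ (L : ℕ) [NeZero L], L₀ ≤ L → ∀ (h S : ℝ), 0 < h → 0 < S →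
      ∀ (N : ℕ) (ψ : Fock (Orb (FermionTorus 2 L))), star ψ ⬝ᵥ ψ = 1 →
        IsGroundStateInSector (hubbardTorusTT' L 1 t' U) N 0 ψ →
        (hubbardTorusTT' L 1 t' U).minEnergyOn (szSector N 0) - μ * N -
            (dWaveSourceTorusTT' L t' U μ h).groundEnergy ≤ S →
        2 * (expect ((pairField dWaveFormFactor L)ᴴ * pairField dWaveFormFactor L) ψ).re ≤
          S ^ 2 / h ^ 2 + D * (L : ℝ) ^ 2 / (2 * S) + Bp * (L : ℝ) ^ 2 := by
  obtain ⟨D, L₀, hD, hDn⟩ := exists_doubleCommutator_budget_TT' t' U μ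
  obtain ⟨Bp, hBp, hpair⟩ := kt_two_mul_re_pair_le_re_order_sq
  refine ⟨D, Bp, L₀, hD, hBp, fun L _ hL h S hh hS N ψ hψ1 hgs hslack => ?_⟩
  set X := pairField dWaveFormFactor L with hX_def
  set O := X + Xᴴ with hO_def
  set K := hubbardTorusTT' L 1 t' U - (μ : ℂ) • totalNumber with hK_def
  have hK : K.IsHermitian := isHermitian_hubbardTorusTT'_sub_smul_totalNumber L t' U μ
  have hO : O.IsHermitian := isHermitian_pairField_add_conjTranspose L
  have hψn : IsNParticle N ψ := ((mem_szSector_iff N 0 ψ).1 hgs.1).1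
  have hNψ := HubbardSuperconductivity.Theorems.WcbcsTrialState.totalNumber_mulVec_of_isNParticle hψn
  have hNh : (totalNumber : Matrix (Finset (Orb (FermionTorus 2 L))) _ ℂ).IsHermitian :=
    totalNumber_isHermitian
  have hNΔ := totalNumber_commutator_pairField_dWave L
  have hV1 : star ψ ⬝ᵥ (O *ᵥ ψ) = 0 := star_dotProduct_charged_mulVec_eq_zero hNh hNΔ hNψ
  have hV3 : star (O *ᵥ ψ) ⬝ᵥ (O *ᵥ (O *ᵥ ψ)) = 0 :=
    star_charged_mulVec_dotProduct_eq_zero hNh hNΔ hNψ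
  -- the eigenvalue equation for `K = H(1,t',U) − μN`
  set Esec : ℝ := (hubbardTorusTT' L 1 t' U).minEnergyOn (szSector N 0) with hEsec
  have hE : K *ᵥ ψ = ((Esec - μ * N : ℝ) : ℂ) • ψ := by
    rw [hK_def, sub_mulVec, smul_mulVec, hgs.2.2, hNψ, smul_smul, ← sub_smul]
    congr 1
    push_cast
    ring
  -- §1 of the `t' = 0` file for `K − hO = dWaveSourceTorusTT' L t' U μ h`
  have hsrc : dWaveSourceTorusTT' L t' U μ h = K - (h : ℂ) • O := rfl
  have hineq : ∀ t : ℝ, (dWaveSourceTorusTT' L t' U μ h).groundEnergy *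
      (1 + t ^ 2 * (star (O *ᵥ ψ) ⬝ᵥ (O *ᵥ ψ)).re) ≤
      (Esec - μ * N) * (1 + t ^ 2 * (star (O *ᵥ ψ) ⬝ᵥ (O *ᵥ ψ)).re)
        - 2 * t * h * (star (O *ᵥ ψ) ⬝ᵥ (O *ᵥ ψ)).re
        - t ^ 2 / 2 * (star ψ ⬝ᵥ ((O * (O * K - K * O) - (O * K - K * O) * O) *ᵥ ψ)).re := by
    intro t
    rw [hsrc]
    exact groundEnergy_source_mul_le_of_eigen hK hO hψ1 hE hV1 hV3 h t
  -- the double-commutator budget bounds `-d`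
  have hdD : -(star ψ ⬝ᵥ ((O * (O * K - K * O) - (O * K - K * O) * O) *ᵥ ψ)).re ≤ D * (L : ℝ) ^ 2 :=
    hDn L hL ψ hψ1
  -- `q = ‖Oψ‖² ≥ 0` and the slack
  have hq0 : 0 ≤ (star (O *ᵥ ψ) ⬝ᵥ (O *ᵥ ψ)).re := by
    rw [star_dotProduct_self_eq_eucNorm_sq, Complex.ofReal_re]; positivity
  have hmain := normSq_le_of_slack hh hS hq0 hdD hslack hineq
  -- `2 Re⟨Δ†Δ⟩ ≤ ‖Oψ‖² + B_p L²`
  have hqO : (expect (O * O) ψ).re = (star (O *ᵥ ψ) ⬝ᵥ (O *ᵥ ψ)).re := by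
    rw [expect, ← mulVec_mulVec, star_dotProduct_mulVec_of_isHermitian hO]
  have hp := hpair L ψ N hψ1 hψn
  rw [hqO] at hp
  linarith

/-! ## §3 From two ENERGY ROWS to a pair-LRO ceiling along `d ∣ L` -/

/-- **Pointwise density form** (`S = sL²`): for every `t', U, μ`, `h > 0`, `s > 0` there are `C ≥ 0` and `L₀`
such that every normalised `(N, S^z = 0)`-sector ground state `ψ` of `hubbardTorusTT' L 1 t' U`, `L ≥ max L₀ 1`,
with sourced slack at most `sL²` has `p_d(L; ψ) ≤ s²/(2h²) + C/L²`. [cite: KomaTasaki1994, Theorem 2.2] -/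
theorem pairFieldDensity_le_of_sourcedSlack_TT' (t' U μ h s : ℝ) (hh : 0 < h) (hs : 0 < s) :
    ∃ C : ℝ, ∃ L₀ : ℕ, 0 ≤ C ∧ ∀ (L : ℕ) [NeZero L], L₀ ≤ L → 1 ≤ L →
      ∀ (N : ℕ) (ψ : Fock (Orb (FermionTorus 2 L))), star ψ ⬝ᵥ ψ = 1 →
        IsGroundStateInSector (hubbardTorusTT' L 1 t' U) N 0 ψ →
        (hubbardTorusTT' L 1 t' U).minEnergyOn (szSector N 0) - μ * N -
            (dWaveSourceTorusTT' L t' U μ h).groundEnergy ≤ s * (L : ℝ) ^ 2 →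
        pairFieldDensity L ψ ≤ s ^ 2 / (2 * h ^ 2) + C / (L : ℝ) ^ 2 := by
  obtain ⟨D, Bp, L₀, hD, hBp, hmain⟩ := two_mul_re_pair_le_of_sourcedSlack_TT' t' U μ
  refine ⟨D / (4 * s) + Bp / 2, L₀, by positivity, fun L _ hL hL1 N ψ hψ1 hgs hslack => ?_⟩
  have hLpos : (0 : ℝ) < (L : ℝ) := by exact_mod_cast (show 0 < L by omega)
  have hSL : 0 < s * (L : ℝ) ^ 2 := by positivity
  have key := hmain L hL h (s * (L : ℝ) ^ 2) hh hSL N ψ hψ1 hgs hslack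
  obtain ⟨L', rfl⟩ : ∃ L', L = L' + 1 := ⟨L - 1, by omega⟩
  set ℓ : ℝ := ((L' + 1 : ℕ) : ℝ) with hℓ
  have hℓ0 : (0 : ℝ) < ℓ := by positivity
  have hℓ1 : (1 : ℝ) ≤ ℓ := by rw [hℓ]; exact_mod_cast hL1
  have hℓ2 : (1 : ℝ) ≤ ℓ ^ 2 := by nlinarith
  have hS' : pairFieldDensity (L' + 1) ψ =
      (expect ((pairField dWaveFormFactor (L' + 1))ᴴ * pairField dWaveFormFactor (L' + 1)) ψ).re /
        ℓ ^ 4 := rfl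
  rw [hS']
  set R : ℝ := (expect ((pairField dWaveFormFactor (L' + 1))ᴴ *
    pairField dWaveFormFactor (L' + 1)) ψ).re with hR
  have hs0 : s ≠ 0 := hs.ne'
  have hh0 : h ≠ 0 := hh.ne'
  have hℓne : ℓ ≠ 0 := hℓ0.ne'
  -- `key : 2R ≤ (sℓ²)²/h² + Dℓ²/(2sℓ²) + B_p ℓ²`
  have e1 : D * ℓ ^ 2 / (2 * (s * ℓ ^ 2)) = D / (2 * s) := by
    field_simp
  have e2 : (s * ℓ ^ 2) ^ 2 / h ^ 2 = 2 * (s ^ 2 / (2 * h ^ 2) * ℓ ^ 4) := by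
    field_simp
  rw [e1, e2] at key
  have hA : 0 ≤ D / (4 * s) := by positivity
  have hAℓ : D / (4 * s) ≤ D / (4 * s) * ℓ ^ 2 := le_mul_of_one_le_right hA hℓ2
  have e3 : D / (2 * s) = 2 * (D / (4 * s)) := by
    field_simp
    ring
  rw [e3] at key
  have hRle : R ≤ s ^ 2 / (2 * h ^ 2) * ℓ ^ 4 + (D / (4 * s) + Bp / 2) * ℓ ^ 2 := by nlinarith
  calc R / ℓ ^ 4
      ≤ (s ^ 2 / (2 * h ^ 2) * ℓ ^ 4 + (D / (4 * s) + Bp / 2) * ℓ ^ 2) / ℓ ^ 4 :=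
        div_le_div_of_nonneg_right hRle (by positivity)
    _ = s ^ 2 / (2 * h ^ 2) + (D / (4 * s) + Bp / 2) / ℓ ^ 2 := by
        field_simp

/-- **THE ROWS FORM at `t'` — an UPPER row on the `t–t'` sector energy and a SOURCED LOWER row give a
pair-LRO ceiling.** Let `d > 0` be even, and suppose on the sides `L ≥ L₁` with `d ∣ L`: the density is exact,
`N_L = ρL²`; the canonical `(N_L, S^z = 0)` sector energy of `hubbardTorusTT' L 1 t' U` obeys `E ≤ e⁺L²`
(UPPER row); the pair-sourced grand-canonical ground energy obeys `e⁻L² ≤ E₀(dWaveSourceTorusTT' L t' U μ h)`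
(SOURCED LOWER row, `h > 0`); and `s := e⁺ − μρ − e⁻ > 0`. Then along EVERY sequence `ψ` of unit
`(N_L, S^z = 0)`-sector ground states of the `t–t'` tori (even sides), `liminf_k σ_d²(2k) ≤ s²/(2h²)`.
[cite: KomaTasaki1994, Theorem 2.2] [cite: TasakiWatanabe2021, discussion after eq. (11)] -/
theorem liminf_dWaveOrderParamSq_le_of_sourcedRows_TT' (t' U μ h : ℝ) (hh : 0 < h) {d : ℕ} (hd : 0 < d)
    (hde : Even d) (N : ℕ → ℕ) (eU eL ρ : ℝ) (L₁ : ℕ) (hs : 0 < eU - μ * ρ - eL)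
    (hN : ∀ L, L₁ ≤ L → d ∣ L → (N L : ℝ) = ρ * (L : ℝ) ^ 2)
    (hup : ∀ (L : ℕ) [NeZero L], L₁ ≤ L → d ∣ L →
      (hubbardTorusTT' L 1 t' U).minEnergyOn (szSector (N L) 0) ≤ eU * (L : ℝ) ^ 2)
    (hlo : ∀ (L : ℕ) [NeZero L], L₁ ≤ L → d ∣ L →
      eL * (L : ℝ) ^ 2 ≤ (dWaveSourceTorusTT' L t' U μ h).groundEnergy)
    (ψ : ∀ L, Fock (Orb (FermionTorus 2 L)))
    (hψ : ∀ L, Even L → star (ψ L) ⬝ᵥ ψ L = 1 ∧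
      IsGroundStateInSector (hubbardTorusTT' L 1 t' U) (N L) 0 (ψ L)) :
    liminf (fun k => dWaveOrderParamSq ψ k) atTop ≤ (eU - μ * ρ - eL) ^ 2 / (2 * h ^ 2) := by
  set s := eU - μ * ρ - eL with hs_def
  obtain ⟨C, L₀, hC0, hC⟩ := pairFieldDensity_le_of_sourcedSlack_TT' t' U μ h s hh hs
  -- the slack on the sides of the rows
  have hslack : ∀ (L : ℕ) [NeZero L], L₁ ≤ L → d ∣ L →
      (hubbardTorusTT' L 1 t' U).minEnergyOn (szSector (N L) 0) - μ * (N L) -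
        (dWaveSourceTorusTT' L t' U μ h).groundEnergy ≤ s * (L : ℝ) ^ 2 := by
    intro L _ hL hdL
    have h1 := hup L hL hdL
    have h2 := hlo L hL hdL
    rw [hN L hL hdL, hs_def]
    nlinarith
  obtain ⟨e, he⟩ := hde
  have he0 : 0 < e := by omega
  have h2 : ∀ j, 2 * (e * j) = d * j := by intro j; rw [he]; ring
  have hej : ∀ j, j ≤ e * j := fun j => Nat.le_mul_of_pos_left j he0
  -- the subsequence `j ↦ k = e·j`, `L = 2k = d·j`
  have hcast : Tendsto (fun j : ℕ => (((2 * (e * j) : ℕ) : ℝ))) atTop atTop := by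
    refine tendsto_natCast_atTop_atTop.comp ?_
    refine tendsto_atTop_mono (fun j => ?_) tendsto_id
    exact le_trans (hej j) (Nat.le_mul_of_pos_left _ (by norm_num))
  have hden : Tendsto (fun j : ℕ => (((2 * (e * j) : ℕ) : ℝ)) ^ 2) atTop atTop :=
    (tendsto_pow_atTop two_ne_zero).comp hcast
  have hlim : Tendsto (fun j : ℕ => C / (((2 * (e * j) : ℕ) : ℝ)) ^ 2) atTop (𝓝 0) :=
    tendsto_const_nhds.div_atTop hden
  -- eventually along the subsequence: σ_d²(e j) ≤ s²/(2h²) + C/(2ej)²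
  have hsub : ∀ᶠ j in atTop,
      dWaveOrderParamSq ψ (e * j) ≤ s ^ 2 / (2 * h ^ 2) + C / (((2 * (e * j) : ℕ) : ℝ)) ^ 2 := by
    filter_upwards [eventually_ge_atTop (max (max L₀ L₁) 1)] with j hj
    have hj0 : L₀ ≤ j := le_trans (le_trans (le_max_left _ _) (le_max_left _ _)) hj
    have hj0' : L₁ ≤ j := le_trans (le_trans (le_max_right _ _) (le_max_left _ _)) hj
    have hj1 : 1 ≤ j := le_trans (le_max_right _ _) hj
    have hk : 1 ≤ e * j := le_trans hj1 (hej j)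
    have hL0 : L₀ ≤ 2 * (e * j) := le_trans hj0 (le_trans (hej j) (by omega))
    have hL0' : L₁ ≤ 2 * (e * j) := le_trans hj0' (le_trans (hej j) (by omega))
    have hL1 : 1 ≤ 2 * (e * j) := by omega
    have hdL : d ∣ 2 * (e * j) := ⟨j, h2 j⟩
    haveI : NeZero (2 * (e * j)) := ⟨by omega⟩
    rw [dWaveOrderParamSq_eq_pairFieldDensity ψ hk]
    exact hC (2 * (e * j)) hL0 hL1 (N (2 * (e * j))) (ψ (2 * (e * j))) (hψ _ (even_two_mul _)).1
      (hψ _ (even_two_mul _)).2 (hslack (2 * (e * j)) hL0' hdL)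
  -- bounded below (eventually nonnegative) along the full sequence
  have hbdd : IsBoundedUnder (· ≥ ·) atTop (fun k => dWaveOrderParamSq ψ k) := by
    refine ⟨0, eventually_map.2 (eventually_atTop.2 ⟨1, fun k hk => ?_⟩)⟩
    show 0 ≤ dWaveOrderParamSq ψ k
    rw [dWaveOrderParamSq_eq_pairFieldDensity ψ hk]
    exact pairFieldDensity_nonneg _ _
  refine le_of_forall_gt_imp_ge_of_dense fun ε hε => ?_
  have hη : 0 < ε - s ^ 2 / (2 * h ^ 2) := sub_pos.2 hε
  have hev : ∀ᶠ j in atTop, dWaveOrderParamSq ψ (e * j) ≤ ε := by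
    filter_upwards [hsub, hlim.eventually (eventually_le_nhds hη)] with j hj hj'
    linarith
  obtain ⟨j₁, hj₁⟩ := eventually_atTop.1 hev
  have hfreq : ∃ᶠ k in atTop, dWaveOrderParamSq ψ k ≤ ε :=
    frequently_atTop.2 fun n =>
      ⟨e * max n j₁, le_trans (le_max_left _ _) (hej _), hj₁ _ (le_max_right _ _)⟩
  exact liminf_le_of_frequently_le hfreq hbdd

end Summit.HubbardSuperconductivity.HubbardLadder

end
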